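import Summits.BirchSwinnertonDyer.BirchSwinnertonDyer.Theorems.PrintCf2RubinValueTwoLinePinClassJunctionOfLine
import Summits.BirchSwinnertonDyer.BirchSwinnertonDyer.Theorems.PrintCf2RubinValueTwoLinePinSlotOneIdentityInnerSpec
import Summits.BirchSwinnertonDyer.BirchSwinnertonDyer.Theorems.PrintCf2RubinValueTwoLinePinInnerSpecializationOfXRegular
import Literature.NumberTheory.QuadraticFields.HeegnerCondition
import HarnessLib

/-!
# M-LINE-PIN, part 11: THE `_of_xRegularInner` ENTRY POINTS (LEAD g14 ruling R-REG₂ / 07:47Z (1)) and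
# the EVEN-CLASS half of the skeleton stub (X) `stub_vLineCharIdeal` in its DA7 binder currency

Cell `bsd-print-cf2`, width seat `bsd-line-cf2c-w8` g4 (prover-bsd-line-cf2c-w8-g4-0), planner g19's named piece M-LINE-PIN (crux child
stmt-BirchSwinnertonDyer-24086 `MainConjClauseAtSplitTwoQuad`; skeleton v1 `Cruxes/MainConjClauseAtSplitTwoQuad/Lines/m_line_pin.lean`, LEAD cf2-p1 g14).
The skeleton displays the junk-killer of the inner specialisation as INNER `T₂`-REGULARITY (R) «`(C T) • x = 0 → x = 0`» instead of S3n′: this file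
re-feeds parts 7/8b/9/10 through -w5 g8's (C5′) `LinePinControl.charIdeal_map_eq_mul_of_slotOne_control_of_innerSpec` (p706942) and LEAD's (C4′)
`LinePinControl.map_mapConstantCoeff_charIdeal_eq_of_xRegularInner_of_ne_bot` (p704959), with `D₂.X` torsion GIVEN (as in the stub) rather than
derived, and then proves the EVEN-CLASS half of (X) in the stub's own binder order: on a DA7 frame (`K` imaginary quadratic, `2 ∤ h_K`,
`d_K = −7`, `ι`, `v ≠ v̄` above `2`, a doubly adapted pair `(κ₁, κ₂; γ₁, γ₂)`, `θ² = 1`) with the two extra displayed conditions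
«`θ` non-trivial on `ker κ₁`» (Müller's, = not stub (T)) and «`pairKer ⊓ I_v̄` trivial on `A_θ`» (even local class), for every `D` with `D.X` f.g.
torsion, no `T₂`-torsion and `π_v(ch D.X) ≠ 0`: `∃ D₁ τ u c, τ ∈ D_v̄ ∧ κ₁ τ = κ₁ γ₁ ∧ (u = 1 ∨ u = −1) ∧ τ = u on A_θ ∧
π_v(ch_{Λ₂} D.X) = ((1+T) − u)^c · ch_Λ(D₁.X)` — `θ_K` with `θ_K² = −7` from `d_K = −7` (`Quadratic.exists_sq_eq_discr`), the road-α curve datum of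
part 5 instantiated at `W := cm7^{(1)}`, `τ` from part 5, `u` from part 6, `D₁ := KellerYin2024.unrDualData`, the slot-1 control internal with finite
kernel (part 9), `c := corank_{ℤ₂}` of its cokernel on the `γ₂`-invariants. The ODD class (`c := 0`, cf2c-w2) and stub (T) (`θ` trivial on `ker κ₁`,
-w5 g8) are the other two cases of (X). `--supports stmt-BirchSwinnertonDyer-24086 --as helper`, Theses-free. HONEST FRAMING: assembly; no summit
statement is proved by this seat; BSD is not proved by any of this. THEOREMS ONLY (no definition, no named fact, no `sorry`).

* `map_charIdeal_eq_span_pow_zpCorank_mul_of_xRegularInner` — part 7 with (`htors`, `hne`, `hX`) in place of (`hD₁`, `hne`, `hfin`).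
* `zpCorank_eq_and_map_charIdeal_eq_span_of_powForm_of_xRegularInner` — part 8b's junction likewise (`hne` derived).
* `exists_sq_eq_neg_seven_of_discr` — `d_K = −7 ⟹ ∃ θ_K : K, θ_K² = −7`.
* `exists_mem_decomp_vbar_apply_eq_of_discr` — part 5 on DA7 binders: `∃ τ ∈ D_v̄, κ₁ τ = κ₁ γ₁`.
* `exists_vLineCharIdeal_charModule_of_even_of_xRegularInner` — THE EVEN-CLASS HALF OF (X), stub binders + (`hθκ`, `hI`).
presearch: as parts 7–10 — assembly of tree theorems. beyond-print theorem: no.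

References: [GreenbergVatsal2000] §2 Cor. (2.3), Prop. (2.4); [GreenbergLNM1716] §3–4; [Washington1997] §13.2; [Delbourgo2008] Ch. X Lemma 10.5.
-/

noncomputable section

open scoped Classical Pointwise AddSubgroup NumberField

-- the summit namespace `Summit.BirchSwinnertonDyer.BirchSwinnertonDyer` repeats the problem name by design (D-0017)
set_option linter.dupNamespace false
set_option autoImplicit false

open NumberField IsDedekindDomain Field WeierstrassCurve Literature.NumberTheory.GaloisRepresentations
  Literature.NumberTheory.EllipticCurves Literature.NumberTheory.EllipticCurves.Module
  Literature.NumberTheory.EllipticCurves.IwasawaAlgebra Literature.NumberTheory.EllipticCurves.GreenbergSelmer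
  Literature.NumberTheory.EllipticCurves.GreenbergVatsal2000 Literature.NumberTheory.EllipticCurves.KellerYin2024
  Literature.NumberTheory.EllipticCurves.IwasawaDual
open Summit.BirchSwinnertonDyer.BirchSwinnertonDyer.Theorems.PrintCf2

namespace Summit.BirchSwinnertonDyer.BirchSwinnertonDyer.Theorems.PrintCf2.LinePin

/-! ## §1. Generic `𝔮 ∣ p`: the (C)∘(C2b) junction and the pin, inner regularity displayed -/

section Generic

variable {K : Type} [Field K] [NumberField K] {p : ℕ} [Fact p.Prime] {κ κ₂ : ZpExtension K p}
  {M : Type} [AddCommGroup M] [DistribMulAction (absoluteGaloisGroup K) M] [TopologicalSpace M] [DiscreteTopology M]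
  {𝔮 : HeightOneSpectrum (𝓞 K)} {γ γ₂ : absoluteGaloisGroup K}
  {g : unrSelmer κ M 𝔮 ∅ →+ unrSelmer₂ κ κ₂ M 𝔮}
  (hg : ∀ t : unrSelmer κ M 𝔮 ∅,
    ((g t : unrSelmer₂ κ κ₂ M 𝔮) : subgroupH1 (ZpExtension.pairKer κ κ₂) M) =
      resOfLe M (ZpExtension.pairKer_le_left κ κ₂) (t : subgroupH1 κ.kerSubgroup M))
  {D₂ : DualData₂ κ κ₂ M 𝔮 γ γ₂} {D₁ : DatumDualData κ γ M (Castella2018.AcSelmer.bdpData M p 𝔮) ∅}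
  {φ : D₂.X →ₛₗ[PowerSeries.map (PowerSeries.constantCoeff (R := ℤ_[p]))] D₁.X}
  (hφ : ∀ (x : D₂.X) (t : unrSelmer κ M 𝔮 ∅), D₁.toDual (φ x) t = D₂.toDual x (g t))
include hg hφ

/-- **(C)∘(C2b) WITH INNER REGULARITY DISPLAYED.** As part 7's `map_charIdeal_eq_span_pow_zpCorank_mul`, with `D₂.X` torsion GIVEN and the
junk-killer «no `T₂`-torsion» (`hX`) in place of S3n′: `C[p]` finite and **`π(charIdeal Λ₂ D₂.X) = span {(1+T) − u} ^ corank_{ℤ_p} C * charIdeal Λ D₁.X`.**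
[cite: GreenbergVatsal2000, §2 Cor. (2.3), Prop. (2.4) (p. 22)] [cite: GreenbergLNM1716, §4 Lemma 4.2] [cite: Delbourgo2008, Ch. X Lemma 10.5] -/
theorem map_charIdeal_eq_span_pow_zpCorank_mul_of_xRegularInner [Module.Finite (IwasawaAlgebra₂ p) D₂.X] [Finite g.ker]
    (hγ : ZpExtension.IsTopGeneratorPair κ κ₂ γ γ₂)
    (hcont : ∀ m : M, Continuous fun σ : absoluteGaloisGroup K ↦ σ • m) (hprim : ∀ m : M, ∃ k : ℕ, p ^ k • m = 0)
    (hκ₂ : κ₂.IsUnramifiedOutside 𝔮) (h𝔮 : ((p : ℕ) : 𝓞 K) ∈ 𝔮.asIdeal)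
    (hI : ∀ y : absoluteGaloisGroup K, y ∈ ZpExtension.pairKer κ κ₂ → y ∈ inertia 𝔮 → ∀ m : M, y • m = m)
    {τ : absoluteGaloisGroup K} (hτ : τ ∈ decomp 𝔮) (hκτ : κ τ = κ γ) {u : ℤ} (hu : ∀ m : M, τ • m = u • m)
    (hpu : (p : ℤ) ∣ u - 1)
    {C : Type*} [AddCommGroup C] (πC : ↥(endInvariants (conjSel₂ κ κ₂ M 𝔮 γ₂ - 1)) →+ C) (hsurj : Function.Surjective πC)
    (hker : ∀ s : ↥(endInvariants (conjSel₂ κ κ₂ M 𝔮 γ₂ - 1)), πC s = 0 ↔ (s : unrSelmer₂ κ κ₂ M 𝔮) ∈ g.range)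
    (htors : Module.IsTorsion (IwasawaAlgebra₂ p) D₂.X)
    (hne : (charIdeal (IwasawaAlgebra₂ p) D₂.X).map (PowerSeries.map (PowerSeries.constantCoeff (R := ℤ_[p]))) ≠ ⊥)
    (hX : ∀ x : D₂.X, (PowerSeries.C (PowerSeries.X : IwasawaAlgebra p) : IwasawaAlgebra₂ p) • x = 0 → x = 0) :
    Finite (C[(p : ℤ)]) ∧
      (charIdeal (IwasawaAlgebra₂ p) D₂.X).map (PowerSeries.map (PowerSeries.constantCoeff (R := ℤ_[p]))) =
        Ideal.span {((1 : IwasawaAlgebra p) + PowerSeries.X) - (u : IwasawaAlgebra p)} ^ zpCorank C p *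
          charIdeal (IwasawaAlgebra p) D₁.X := by
  letI instQ : Module (IwasawaAlgebra p) (QuotSMulTop (PowerSeries.C (PowerSeries.X : IwasawaAlgebra p) : IwasawaAlgebra₂ p) D₂.X) :=
    Module.compHom _ (PowerSeries.map (PowerSeries.C (R := ℤ_[p])))
  -- (C4′): the inner specialisation under inner regularity
  have hC4 := LinePinControl.map_mapConstantCoeff_charIdeal_eq_of_xRegularInner_of_ne_bot D₂ htors hne hX
  -- (C5′): the kernel-form identity
  obtain ⟨φbar, hφbar, hid, -⟩ := LinePinControl.charIdeal_map_eq_mul_of_slotOne_control_of_innerSpec hg hφ htors hne hC4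
  -- (C2b): the defect term
  obtain ⟨hfinC, -⟩ := finite_torsionBy_and_zpCorank_eq_lambdaInvariant_ker_liftQ hg hφ hγ hcont hprim hκ₂ h𝔮 hI hτ hκτ hu hpu
    πC hsurj hker φbar hφbar
  refine ⟨hfinC, ?_⟩
  rw [hid, charIdeal_ker_liftQ_eq_span_pow_zpCorank hg hφ hγ hcont hprim hκ₂ h𝔮 hI hτ hκτ hu hpu πC hsurj hker φbar hφbar]

/-- **THE PIN WITH INNER REGULARITY DISPLAYED.** As part 8b's `zpCorank_eq_and_map_charIdeal_eq_span_of_powForm` with (`htors`, `hX`) in place of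
(`hD₁`, `hfin`): (Q) + (C)∘(C2b) + (M) + (A) ⟹ **`corank_{ℤ_p} C = d`, `a = b`, `(ch_{Λ₂} D₂.X).map (map (map J)) = (G₂)`.**
[cite: Washington1997, §13.2] [cite: deShalit1987, II.4.12] [cite: Mueller2020MCSplitTwo, Thm. 1.3] -/
theorem zpCorank_eq_and_map_charIdeal_eq_span_of_powForm_of_xRegularInner [Module.Finite (IwasawaAlgebra₂ p) D₂.X] [Finite g.ker]
    (hγ : ZpExtension.IsTopGeneratorPair κ κ₂ γ γ₂)
    (hcont : ∀ m : M, Continuous fun σ : absoluteGaloisGroup K ↦ σ • m) (hprim : ∀ m : M, ∃ k : ℕ, p ^ k • m = 0)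
    (hκ₂ : κ₂.IsUnramifiedOutside 𝔮) (h𝔮 : ((p : ℕ) : 𝓞 K) ∈ 𝔮.asIdeal)
    (hI : ∀ y : absoluteGaloisGroup K, y ∈ ZpExtension.pairKer κ κ₂ → y ∈ inertia 𝔮 → ∀ m : M, y • m = m)
    {τ : absoluteGaloisGroup K} (hτ : τ ∈ decomp 𝔮) (hκτ : κ τ = κ γ) {u : ℤ} (hu : ∀ m : M, τ • m = u • m)
    (hpu : (p : ℤ) ∣ u - 1)
    {C : Type*} [AddCommGroup C] (πC : ↥(endInvariants (conjSel₂ κ κ₂ M 𝔮 γ₂ - 1)) →+ C) (hsurj : Function.Surjective πC)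
    (hker : ∀ s : ↥(endInvariants (conjSel₂ κ κ₂ M 𝔮 γ₂ - 1)), πC s = 0 ↔ (s : unrSelmer₂ κ κ₂ M 𝔮) ∈ g.range)
    (htors : Module.IsTorsion (IwasawaAlgebra₂ p) D₂.X)
    (hX : ∀ x : D₂.X, (PowerSeries.C (PowerSeries.X : IwasawaAlgebra p) : IwasawaAlgebra₂ p) • x = 0 → x = 0)
    (J : ℤ_[p] →+* PadicComplexInt p) (G₂ : PowerSeries (PowerSeries (PadicComplexInt p)))
    (F : IwasawaAlgebra₂ p) (hF : charIdeal (IwasawaAlgebra₂ p) D₂.X = Ideal.span {F})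
    {a b : ℕ} (hQ : Ideal.span ({((p : ℕ) : PowerSeries (PowerSeries (PadicComplexInt p))) ^ a *
        PowerSeries.map (PowerSeries.map J) F} : Set (PowerSeries (PowerSeries (PadicComplexInt p)))) =
      Ideal.span {((p : ℕ) : PowerSeries (PowerSeries (PadicComplexInt p))) ^ b * G₂})
    (G₁ : PowerSeries (PadicComplexInt p)) (hG₁ : G₁ ≠ 0)
    (hM : (charIdeal (IwasawaAlgebra p) D₁.X).map (PowerSeries.map J) = Ideal.span {G₁}) {d : ℕ}
    (hA : Ideal.span ({PowerSeries.map (PowerSeries.constantCoeff (R := PadicComplexInt p)) G₂} : Set (PowerSeries (PadicComplexInt p))) =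
      Ideal.span {((1 : PowerSeries (PadicComplexInt p)) + PowerSeries.X) - (u : PowerSeries (PadicComplexInt p))} ^ d *
        Ideal.span {G₁}) :
    zpCorank C p = d ∧ a = b ∧
      (charIdeal (IwasawaAlgebra₂ p) D₂.X).map (PowerSeries.map (PowerSeries.map J)) = Ideal.span {G₂} := by
  have hne := map_constantCoeff_charIdeal_ne_bot_of_powForm_pow D₂ J G₂ F hF hQ u G₁ hG₁ hA
  obtain ⟨-, hC⟩ := map_charIdeal_eq_span_pow_zpCorank_mul_of_xRegularInner hg hφ hγ hcont hprim hκ₂ h𝔮 hI hτ hκτ hu hpu πC hsurj hker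
    htors hne hX
  exact eq_and_map_charIdeal_eq_span_of_powForm D₂ J G₂ F hF hQ hpu hC G₁ hG₁ hM hA

end Generic

/-! ## §2. The DA7 frame: `θ_K` from `d_K = −7`, `τ ∈ D_v̄` with `κ₁ τ = κ₁ γ₁` -/

section Frame

variable {K : Type} [Field K] [NumberField K]

/-- `d_K = −7` for a quadratic `K` ⟹ `∃ θ_K : K, θ_K² = −7` (`√d_K ∈ 𝓞 K`). [folklore] -/
theorem exists_sq_eq_neg_seven_of_discr (hK : IsImaginaryQuadratic K) (hdisc : NumberField.discr K = -7) : ∃ θK : K, θK ^ 2 = -7 := by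
  obtain ⟨-, -, δ, -, hδ⟩ := Literature.NumberTheory.QuadraticFields.Quadratic.exists_sq_eq_discr (K := K) hK.1
  refine ⟨(δ : K), ?_⟩
  have h := congrArg ((↑) : 𝓞 K → K) hδ
  push_cast at h
  rw [h, hdisc]
  norm_num [map_ofNat]

/-- **`v̄` is undecomposed in the `v`-line, DA7 binders** (part 5 `exists_mem_decomp_vbar_apply_eq_of_isUnramifiedOutside` with the road-α curve datum
instantiated at `W := cm7^{(1)}` and `θ_K` from `d_K = −7`): `∃ τ ∈ D_v̄, κ₁ τ = κ₁ γ₁`. [cite: Washington1997, §13.1] [cite: NeukirchANT1999, Ch. II §5] -/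
theorem exists_mem_decomp_vbar_apply_eq_of_discr (hK : IsImaginaryQuadratic K) (hdisc : NumberField.discr K = -7)
    {v vbar : HeightOneSpectrum (𝓞 K)} (hv : ((2 : ℕ) : 𝓞 K) ∈ v.asIdeal) (hvbar : ((2 : ℕ) : 𝓞 K) ∈ vbar.asIdeal) (hne : vbar ≠ v)
    (κ₁ : ZpExtension K 2) (hκ₁ : κ₁.IsUnramifiedOutside v) {γ₁ : absoluteGaloisGroup K} (hγ₁ : κ₁.IsTopGenerator γ₁) :
    ∃ τ ∈ decomp vbar, κ₁ τ = κ₁ γ₁ := by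
  obtain ⟨θK, hθK⟩ := exists_sq_eq_neg_seven_of_discr hK hdisc
  haveI : (cm7.quadraticTwist ((1 : ℤ) : ℚ)).IsElliptic := cm7.isElliptic_quadraticTwist (by norm_num)
  have hCW : (1 : VariableChange ℚ) • cm7.quadraticTwist ((1 : ℤ) : ℚ) = cm7.quadraticTwist ((1 : ℤ) : ℚ) := one_smul _ _
  exact exists_mem_decomp_vbar_apply_eq_of_isUnramifiedOutside hK hθK one_ne_zero (cm7.quadraticTwist ((1 : ℤ) : ℚ)) hCW hv hvbar hne κ₁
    hκ₁ hγ₁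

end Frame

/-! ## §3. The even-class half of stub (X) `stub_vLineCharIdeal`, in its binder currency -/

section StubX

/-- **(X) `stub_vLineCharIdeal`, EVEN CLASS, `θ` NON-TRIVIAL ON `ker κ₁`.** The binders of the skeleton stub VERBATIM (DA7 frame, doubly adapted pair,
`θ² = 1`), then the two displayed class conditions `hθκ : ∃ σ ∈ κ₁.kerSubgroup, θ σ ≠ 1` (Müller's; the complement is stub (T)) and
`hI : pairKer ⊓ I_v̄` trivial on `A_θ` (even local class; the complement is cf2c-w2's odd class with `c := 0`), then the stub's `D`-binders (f.g.,
torsion, no `T₂`-torsion, `π_v(ch D.X) ≠ 0`); conclusion VERBATIM the stub's: **`∃ D₁ τ u c, τ ∈ D_v̄ ∧ κ₁ τ = κ₁ γ₁ ∧ (u = 1 ∨ u = −1) ∧ τ = u on A_θ ∧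
π_v(ch_{Λ₂} D.X) = ((1+T) − u)^c · ch_Λ(D₁.X)`** with `c = corank_{ℤ₂}` of the cokernel of the slot-1 control on the `γ₂`-invariants.
[cite: GreenbergVatsal2000, §2 Cor. (2.3), Prop. (2.4)] [cite: GreenbergLNM1716, §3 Lemmas 3.1–3.2, §4 Lemma 4.2] [cite: Delbourgo2008, Ch. X Lemma 10.5] -/
theorem exists_vLineCharIdeal_charModule_of_even_of_xRegularInner :
    ∀ (K : Type) [Field K] [NumberField K], IsImaginaryQuadratic K → ¬ 2 ∣ NumberField.classNumber K →
      NumberField.discr K = -7 →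
    ∀ (ι : PadicAlgCl 2 ≃+* ℂ) (v vbar : HeightOneSpectrum (𝓞 K)),
      ((2 : ℕ) : 𝓞 K) ∈ v.asIdeal → ((2 : ℕ) : 𝓞 K) ∈ vbar.asIdeal → vbar ≠ v →
      (∀ (w : InfinitePlace K) (k : 𝓞 K), k ∈ v.asIdeal ↔ ‖ι.symm (w.embedding (k : K))‖ < 1) →
    ∀ (κ₁ κ₂ : ZpExtension K 2) (γ₁ γ₂ : absoluteGaloisGroup K),
      ZpExtension.IsTopGeneratorPair κ₁ κ₂ γ₁ γ₂ → κ₂.IsUnramifiedOutside vbar →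
      κ₁.IsUnramifiedOutside v → γ₁ ∈ GreenbergSelmer.inertia v → γ₂ ∈ GreenbergSelmer.inertia vbar →
    ∀ (θ : FramedGaloisRep K (padicCoeffIntegers (∅ : Set (PadicAlgCl 2))) 1),
      (∀ σ : absoluteGaloisGroup K, θ σ ^ 2 = 1) →
      (∃ σ ∈ κ₁.kerSubgroup, θ σ ≠ 1) →
      (∀ y : absoluteGaloisGroup K, y ∈ ZpExtension.pairKer κ₁ κ₂ → y ∈ GreenbergSelmer.inertia vbar →
        ∀ m : KellerYin2024.charModule (∅ : Set (PadicAlgCl 2)) θ, y • m = m) →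
    ∀ D : DualData₂ κ₁ κ₂ (KellerYin2024.charModule (∅ : Set (PadicAlgCl 2)) θ) vbar γ₁ γ₂,
      Module.Finite (IwasawaAlgebra₂ 2) D.X → Module.IsTorsion (IwasawaAlgebra₂ 2) D.X →
      (∀ x : D.X, (PowerSeries.C (PowerSeries.X : IwasawaAlgebra 2) : IwasawaAlgebra₂ 2) • x = 0 → x = 0) →
      (Module.charIdeal (IwasawaAlgebra₂ 2) D.X).map (PowerSeries.map (PowerSeries.constantCoeff (R := ℤ_[2]))) ≠ ⊥ →
    ∃ (D₁ : DatumDualData κ₁ γ₁ (KellerYin2024.charModule (∅ : Set (PadicAlgCl 2)) θ)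
        (Castella2018.AcSelmer.bdpData (KellerYin2024.charModule (∅ : Set (PadicAlgCl 2)) θ) 2 vbar) ∅)
      (τ : absoluteGaloisGroup K) (u : ℤ) (c : ℕ),
      τ ∈ GreenbergSelmer.decomp vbar ∧ κ₁ τ = κ₁ γ₁ ∧ (u = 1 ∨ u = -1) ∧
      (∀ m : KellerYin2024.charModule (∅ : Set (PadicAlgCl 2)) θ, τ • m = u • m) ∧
      (Module.charIdeal (IwasawaAlgebra₂ 2) D.X).map (PowerSeries.map (PowerSeries.constantCoeff (R := ℤ_[2]))) =
        Ideal.span {((1 : IwasawaAlgebra 2) + PowerSeries.X) - (u : IwasawaAlgebra 2)} ^ c *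
          Module.charIdeal (IwasawaAlgebra 2) D₁.X := by
  intro K _ _ hK _h2 hdisc _ι v vbar hv hvbar hne _hι κ₁ κ₂ γ₁ γ₂ hγ hκ₂ hκ₁ _hγ₁I _hγ₂I θ hθ2 hθκ hI D hfg htors hX hne0
  haveI := hfg
  -- the frame: `τ ∈ D_v̄` with `κ₁ τ = κ₁ γ₁` (part 5), acting on `A_θ` by `u = ±1` (part 6)
  obtain ⟨τ, hτ, hκτ⟩ := exists_mem_decomp_vbar_apply_eq_of_discr hK hdisc hv hvbar hne κ₁ hκ₁ hγ.left
  obtain ⟨u, hu1, hpu, hu⟩ := exists_int_smul_charModule_of_sq_eq_one θ (hθ2 τ)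
  -- side conditions of the character module
  have hcont : ∀ m : charModule (∅ : Set (PadicAlgCl 2)) θ, Continuous fun σ : absoluteGaloisGroup K ↦ σ • m :=
    fun m ↦ CharResidualSelmerCount.continuous_smul_charModule θ m
  have hprim : ∀ m : charModule (∅ : Set (PadicAlgCl 2)) θ, ∃ k : ℕ, 2 ^ k • m = 0 :=
    fun m ↦ exists_pow_smul_cofree_eq_zero (∅ : Set (PadicAlgCl 2)) θ m
  have hstab : ∀ m : charModule (∅ : Set (PadicAlgCl 2)) θ,
      IsOpen (MulAction.stabilizer (absoluteGaloisGroup K) m : Set (absoluteGaloisGroup K)) :=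
    fun m ↦ isOpen_stabilizer_cofree (∅ : Set (PadicAlgCl 2)) θ m
  -- the one-variable datum, the slot-1 control with its transpose and finite kernel, and a presentation of its cokernel
  let D₁ : DatumDualData κ₁ γ₁ (charModule (∅ : Set (PadicAlgCl 2)) θ)
      (Castella2018.AcSelmer.bdpData (charModule (∅ : Set (PadicAlgCl 2)) θ) 2 vbar) ∅ :=
    unrDualData κ₁ vbar ∅ hprim hstab hγ.left
  obtain ⟨g, hg⟩ := LinePinControl.exists_lineRes_unr κ₁ κ₂ (charModule (∅ : Set (PadicAlgCl 2)) θ) vbar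
  obtain ⟨φ, hφ⟩ := LinePinControl.exists_transpose_unr hg hγ hprim hstab D D₁
  haveI : Finite g.ker := finite_ker_lineRes_unr_charModule hγ θ hθ2 hθκ hg
  obtain ⟨N, hN⟩ : ∃ N : AddSubgroup ↥(endInvariants (conjSel₂ κ₁ κ₂ (charModule (∅ : Set (PadicAlgCl 2)) θ) vbar γ₂ - 1)),
      ∀ s, s ∈ N ↔ (s : unrSelmer₂ κ₁ κ₂ (charModule (∅ : Set (PadicAlgCl 2)) θ) vbar) ∈ g.range :=
    ⟨g.range.comap (AddSubgroup.subtype _), fun s ↦ by rw [AddSubgroup.mem_comap, AddSubgroup.coe_subtype]⟩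
  have hker : ∀ s : ↥(endInvariants (conjSel₂ κ₁ κ₂ (charModule (∅ : Set (PadicAlgCl 2)) θ) vbar γ₂ - 1)),
      QuotientAddGroup.mk' N s = 0 ↔ (s : unrSelmer₂ κ₁ κ₂ (charModule (∅ : Set (PadicAlgCl 2)) θ) vbar) ∈ g.range :=
    fun s ↦ (QuotientAddGroup.eq_zero_iff s).trans (hN s)
  obtain ⟨-, hC⟩ := map_charIdeal_eq_span_pow_zpCorank_mul_of_xRegularInner hg hφ hγ hcont hprim hκ₂ hvbar hI hτ hκτ hu hpu
    (QuotientAddGroup.mk' N) (QuotientAddGroup.mk'_surjective N) hker htors hne0 hX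
  exact ⟨D₁, τ, u, _, hτ, hκτ, hu1, hu, hC⟩

end StubX

end Summit.BirchSwinnertonDyer.BirchSwinnertonDyer.Theorems.PrintCf2.LinePin

end
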